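import Summits.KontsevichZagierPeriods.KontsevichZagierPeriods.Theses.ZeroPortrait
import Summits.KontsevichZagierPeriods.KontsevichZagierPeriods.Theorems.FurushoPentagonReducedPeriodRingCubeMerge
import Summits.KontsevichZagierPeriods.KontsevichZagierPeriods.Theorems.TerasomaMultiplicationBetaCancellationOfAyoubPiCancellation
import Literature.NumberTheory.Transcendental.KZCalculusProofs
import Literature.NumberTheory.Transcendental.KZCubicalCalculus
import Literature.NumberTheory.Transcendental.KZProductIdeal

/-!
# Birth skeleton (BC3) of leaf 2 `CubicalPiLocalKernelModPencils` of the Ayoub–π split of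
`ZeroPortrait.PencilComplete` (stmt-KontsevichZagierPeriods-11731)

Leaf 2 = Ayoub's effective cube kernel, LOCALISED at the disc class `[π]` and taken MODULO the pencil
sector of route ZeroPortrait: `∀ pinned P, ∀ a ∈ cubicalSpan (tame cube classes), eval a = 0 →
∃ N, (liftP P)^[N] a ∈ pencilSector`. It is cut along Ayoub's own presentation
[Ayoub, EMS Newsl. 91 (2014), Def. 9 (`𝒪_alg(𝔻̄ⁿ)` = power series converging on a neighbourhood of
the CLOSED unit polydisc, algebraic over `ℚ(z)`), Def. 10, Rem. 13 (`Ev [f] = ∫_{[0,1]ⁿ} f`), Conj. 7]: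

* `stub_polydiscNormalForm` — ANALYSIS / cubical bookkeeping (provable now, size L): every element of
  the tame cubical span is congruent modulo `KZ.relations` to ONE cube class whose integrand is the
  restriction of a function holomorphic on a neighbourhood of the closed unit polydisc (radius
  `t > 1`). Plan: `stub_cubeMerge` (LANDED, `FurushoPentagonReducedPeriodRingCubeMerge`) merges to one
  tame class `[[0,1]ⁿ, g]`, `g` real-analytic near the cube hence holomorphic on a complex
  `δ`-neighbourhood; dyadic subdivision to depth `k` with `2^{-k}√n < δ` (generators
  `KZ.cubicalSubdivGens ⊆ relations`, `KZCubicalCalculus`) rescales each piece to a function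
  holomorphic on the polydisc of radius `2^k δ/√n > 1`; re-merge the `2^{kn}` pieces of equal
  dimension by integrand additivity (`KZ.cubicalLinGens`). Semialgebraicity is preserved by affine maps.
* `stub_ayoubKernelModPencils` — the TRANSCENDENCE CORE in Ayoub's generators (open, GPC-strength):
  a single polydisc-holomorphic cube class of value `0` is carried into the pencil sector by a power
  of the pinned disc operator. This is Conjecture 1 / Ayoub's Conj. 7 for ONE generator of his
  presentation, localised and relative to the pencils; crux-implied (`N = 0`), summit-implied.

Composition `CubicalPiLocalKernelModPencils_of` (proved): merge-and-normalise `a ≡ [R]` (stub 1),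
`R.value = eval a = 0` (soundness `relations ≤ ker eval`), stub 2 on `R`, and transport of the
difference `a − [R] ∈ relations` through `(liftP P)^[N]` (a pinned disc operator preserves the
relations: left-ideal property `KZ.mul_mem_relations_left_holds` + the landed
`piRep_mul_sub_lift_mem_relations`). Sorries live only in the two stubs.
-/

noncomputable section

set_option linter.dupNamespace false

namespace Summit.KontsevichZagierPeriods.KontsevichZagierPeriods.Cruxes.CubicalPiLocalKernelModPencils.Birth

open MeasureTheory Set
open Literature.NumberTheory.Transcendental
open Literature.NumberTheory.Transcendental.KZ hiding cubicalSpan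
open Summit.KontsevichZagierPeriods.FurushoPentagon.ReducedPeriodRing (unitCube cubicalGens cubicalSpan)
open Summit.KontsevichZagierPeriods.KontsevichZagierPeriods.BetaCancellationLine (piRep_mul_sub_lift_mem_relations)

/-- **Leaf 2** of the split, verbatim as filed (child `ZeroPortrait.CubicalPiLocalKernelModPencils`).
[cite: Ayoub2014, Conj. 7] [cite: KontsevichZagier2001, §4.1] -/
def CubicalPiLocalKernelModPencils : Prop :=
  ∀ (P : ∀ n : ℕ, Literature.NumberTheory.Transcendental.KZ.IntegralRep n → Literature.NumberTheory.Transcendental.KZ.IntegralRep (n + 2)), (∀ (n : ℕ) (r : Literature.NumberTheory.Transcendental.KZ.IntegralRep n), (P n r).domain = {z : Fin (n + 2) → ℝ | z 0 ^ 2 + z 1 ^ 2 ≤ 1 ∧ (fun i : Fin n => z i.succ.succ) ∈ r.domain} ∧ (P n r).integrand = fun z => r.integrand (fun i : Fin n => z i.succ.succ)) → ∀ a ∈ AddSubgroup.closure {d : Literature.NumberTheory.Transcendental.KZ.FormalRep | ∃ (n : ℕ) (ρ : Literature.NumberTheory.Transcendental.KZ.IntegralRep n), ρ.domain = {x | ∀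 i, 0 ≤ x i ∧ x i ≤ 1} ∧ AnalyticOnNhd ℝ ρ.integrand {x | ∀ i, 0 ≤ x i ∧ x i ≤ 1} ∧ d = Literature.NumberTheory.Transcendental.KZ.of ρ}, Literature.NumberTheory.Transcendental.KZ.eval a = 0 → ∃ N : ℕ, (⇑(FreeAbelianGroup.lift (fun s : (Σ n, Literature.NumberTheory.Transcendental.KZ.IntegralRep n) => Literature.NumberTheory.Transcendental.KZ.of (P s.1 s.2))))^[N] a ∈ (Literature.NumberTheory.Transcendental.KZ.relations ⊔ AddSubgroup.closure {d | ∃ (a b c s : ℚ) (r : Literature.NumberTheory.Transcendental.KZ.IntegralRep 2) (r' : Literature.NumberTheory.Transcendental.KZ.IntegralRep 1), 0 < s ∧ s < 1 ∧ r.domain = {x | ∀ i, x i ∈ Set.Ioo (0:ℝ) 1} ∧ Set.EqOn r.integrand (fun x => (a : ℝ) * (1 / Real.sqrt ((1 - x 0 ^ 2) * (1 - (s : ℝ) * x 0 ^ 2)) * (1 / Real.sqrt ((1 - x 1 ^ 2) * (1 - (s : ℝ) * x 1 ^ 2)))) + (b : ℝ) * (Real.sqrt (1 - (s : ℝ) *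 x 0 ^ 2) / Real.sqrt (1 - x 0 ^ 2) * (1 / Real.sqrt ((1 - x 1 ^ 2) * (1 - (s : ℝ) * x 1 ^ 2)))) + (c : ℝ) * (Real.sqrt (1 - (s : ℝ) * x 0 ^ 2) / Real.sqrt (1 - x 0 ^ 2) * (Real.sqrt (1 - (s : ℝ) * x 1 ^ 2) / Real.sqrt (1 - x 1 ^ 2)))) r.domain ∧ r'.domain = Set.univ ∧ Set.EqOn r'.integrand (fun x => 1 / (2 * (1 + x 0 ^ 2))) r'.domain ∧ r.value = r'.value ∧ d = Literature.NumberTheory.Transcendental.KZ.of r - Literature.NumberTheory.Transcendental.KZ.of r'} ⊔ AddSubgroup.closure {d | ∃ (s : ℚ) (r r' : Literature.NumberTheory.Transcendental.KZ.IntegralRep 2), 0 < s ∧ r.domain = {x | ∀ i, x i ∈ Set.Ioo (0:ℝ) 1} ∧ Set.EqOn r.integrand (fun x => (x 0) ^ ((s : ℝ) - 1) * (1 - x 0) ^ (-(5:ℝ)/9) * (x 1) ^ (-(4:ℝ)/9) * (1 - x 1) ^ (-(2:ℝ)/9)) r.domain ∧ r'.domain = {x | x 0 ^ 2 + x 1 ^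 2 < 4} ∧ Set.EqOn r'.integrand (fun _ => (3:ℝ) ^ ((7:ℝ)/6) / 2) r'.domain ∧ r.value = r'.value ∧ d = Literature.NumberTheory.Transcendental.KZ.of r - Literature.NumberTheory.Transcendental.KZ.of r'})

/-- The pencil sector of route ZeroPortrait (verbatim). [folklore] -/
def pencilSector : AddSubgroup FormalRep :=
  Literature.NumberTheory.Transcendental.KZ.relations ⊔ AddSubgroup.closure {d | ∃ (a b c s : ℚ) (r : Literature.NumberTheory.Transcendental.KZ.IntegralRep 2) (r' : Literature.NumberTheory.Transcendental.KZ.IntegralRep 1), 0 < s ∧ s < 1 ∧ r.domain = {x | ∀ i, x i ∈ Set.Ioo (0:ℝ) 1} ∧ Set.EqOn r.integrand (fun x => (a : ℝ) * (1 / Real.sqrt ((1 - x 0 ^ 2) * (1 - (s : ℝ) * x 0 ^ 2)) * (1 / Real.sqrt ((1 - x 1 ^ 2) * (1 - (s : ℝ) * x 1 ^ 2)))) + (b : ℝ) * (Real.sqrt (1 - (s : ℝ) * x 0 ^ 2) / Real.sqrt (1 - x 0 ^ 2) * (1 / Real.sqrt ((1 - x 1 ^ 2) * (1 - (s : ℝ)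 * x 1 ^ 2)))) + (c : ℝ) * (Real.sqrt (1 - (s : ℝ) * x 0 ^ 2) / Real.sqrt (1 - x 0 ^ 2) * (Real.sqrt (1 - (s : ℝ) * x 1 ^ 2) / Real.sqrt (1 - x 1 ^ 2)))) r.domain ∧ r'.domain = Set.univ ∧ Set.EqOn r'.integrand (fun x => 1 / (2 * (1 + x 0 ^ 2))) r'.domain ∧ r.value = r'.value ∧ d = Literature.NumberTheory.Transcendental.KZ.of r - Literature.NumberTheory.Transcendental.KZ.of r'} ⊔ AddSubgroup.closure {d | ∃ (s : ℚ) (r r' : Literature.NumberTheory.Transcendental.KZ.IntegralRep 2), 0 < s ∧ r.domain = {x | ∀ i, x i ∈ Set.Ioo (0:ℝ) 1} ∧ Set.EqOn r.integrand (fun x => (x 0) ^ ((s : ℝ) - 1) * (1 - x 0) ^ (-(5:ℝ)/9) * (x 1) ^ (-(4:ℝ)/9) * (1 - x 1) ^ (-(2:ℝ)/9)) r.domain ∧ r'.domain = {x | x 0 ^ 2 + x 1 ^ 2 < 4} ∧ Set.EqOn r'.integrand (fun _ => (3:ℝ) ^ ((7:ℝ)/6) / 2) r'.domain ∧ r.value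 = r'.value ∧ d = Literature.NumberTheory.Transcendental.KZ.of r - Literature.NumberTheory.Transcendental.KZ.of r'}

/-- The pinning hypothesis of items 0540/0541. [folklore] -/
def IsPinnedDisc (P : ∀ n : ℕ, IntegralRep n → IntegralRep (n + 2)) : Prop :=
  ∀ (n : ℕ) (r : IntegralRep n), (P n r).domain = {z : Fin (n + 2) → ℝ | z 0 ^ 2 + z 1 ^ 2 ≤ 1 ∧
    (fun i : Fin n => z i.succ.succ) ∈ r.domain} ∧
    (P n r).integrand = fun z => r.integrand (fun i : Fin n => z i.succ.succ)

/-- The additive extension of a pinned operator. [folklore] -/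
def liftP (P : ∀ n : ℕ, IntegralRep n → IntegralRep (n + 2)) : FormalRep →+ FormalRep :=
  FreeAbelianGroup.lift (fun s : (Σ n, IntegralRep n) => of (P s.1 s.2))

/-- **Ayoub's generators**: a cube class whose integrand is the restriction to `[0,1]ⁿ` of a function
holomorphic on the open polydisc of some radius `t > 1` (i.e. on a neighbourhood of the closed unit
polydisc). [cite: Ayoub2014, Def. 9] -/
def IsPolydiscCube {n : ℕ} (R : IntegralRep n) : Prop :=
  R.domain = {x | ∀ i, 0 ≤ x i ∧ x i ≤ 1} ∧ (∃ (t : ℝ) (F : (Fin n → ℂ) → ℂ), 1 < t ∧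
    AnalyticOnNhd ℂ F {z : Fin n → ℂ | ∀ i, ‖z i‖ < t} ∧
    ∀ x ∈ R.domain, ((R.integrand x : ℝ) : ℂ) = F (fun i => ((x i : ℝ) : ℂ)))

/-- Leaf 2 through the bridges. [folklore] -/
theorem leaf_iff : CubicalPiLocalKernelModPencils ↔
    ∀ P, IsPinnedDisc P → ∀ a ∈ cubicalSpan, eval a = 0 → ∃ N : ℕ, (liftP P)^[N] a ∈ pencilSector :=
  Iff.rfl

/-! ## The two stubs (sorries live only here) -/

/-- **Stub 1 — polydisc normal form of the tame cubical span** (merge + dyadic subdivision +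
re-merge; provable now, size L). [cite: Ayoub2014, Def. 9 and Rem. 13] -/
theorem stub_polydiscNormalForm :
    ∀ a ∈ AddSubgroup.closure {d : Literature.NumberTheory.Transcendental.KZ.FormalRep | ∃ (n : ℕ) (ρ : Literature.NumberTheory.Transcendental.KZ.IntegralRep n), ρ.domain = {x | ∀ i, 0 ≤ x i ∧ x i ≤ 1} ∧ AnalyticOnNhd ℝ ρ.integrand {x | ∀ i, 0 ≤ x i ∧ x i ≤ 1} ∧ d = Literature.NumberTheory.Transcendental.KZ.of ρ}, ∃ (n : ℕ) (R : Literature.NumberTheory.Transcendental.KZ.IntegralRep n), (R.domain = {x | ∀ i, 0 ≤ x i ∧ x i ≤ 1} ∧ (∃ (t : ℝ) (F : (Fin n → ℂ) → ℂ), 1 < t ∧ AnalyticOnNhd ℂ F {z : Fin n → ℂ | ∀ i, ‖z i‖ < t} ∧ ∀ x ∈ R.domain, ((R.integrand x : ℝ) : ℂ) = F (fun i => ((x i : ℝ) : ℂ)))) ∧ a - Literature.NumberTheory.Transcendental.KZ.of R ∈ Literature.NumberTheory.Transcendental.KZ.relations := by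
  sorry

/-- **Stub 2 — Ayoub's kernel on ONE polydisc generator, localised at `[π]`, modulo the pencils**
(the transcendence core; open, GPC-strength; crux- and summit-implied). [cite: Ayoub2014, Conj. 7]
[cite: HuberWustholz2022, App. A.4] -/
theorem stub_ayoubKernelModPencils :
    ∀ (P : ∀ n : ℕ, Literature.NumberTheory.Transcendental.KZ.IntegralRep n → Literature.NumberTheory.Transcendental.KZ.IntegralRep (n + 2)), (∀ (n : ℕ) (r : Literature.NumberTheory.Transcendental.KZ.IntegralRep n), (P n r).domain = {z : Fin (n + 2) → ℝ | z 0 ^ 2 + z 1 ^ 2 ≤ 1 ∧ (fun i : Fin n => z i.succ.succ) ∈ r.domain} ∧ (P n r).integrand = fun z => r.integrand (fun i : Fin n => z i.succ.succ)) → ∀ (n : ℕ) (R : Literature.NumberTheory.Transcendental.KZ.IntegralRep n), (R.domain = {x | ∀ i, 0 ≤ x i ∧ x i ≤ 1} ∧ (∃ (t : ℝ) (F : (Fin n → ℂ) → ℂ), 1 < t ∧ AnalyticOnNhd ℂ F {z : Fin n → ℂ | ∀ i, ‖z i‖ < t} ∧ ∀ x ∈ R.domain, ((R.integrand x : ℝ)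 : ℂ) = F (fun i => ((x i : ℝ) : ℂ)))) → R.value = 0 → ∃ N : ℕ, (⇑(FreeAbelianGroup.lift (fun s : (Σ n, Literature.NumberTheory.Transcendental.KZ.IntegralRep n) => Literature.NumberTheory.Transcendental.KZ.of (P s.1 s.2))))^[N] (Literature.NumberTheory.Transcendental.KZ.of R) ∈ Literature.NumberTheory.Transcendental.KZ.relations ⊔ AddSubgroup.closure {d | ∃ (a b c s : ℚ) (r : Literature.NumberTheory.Transcendental.KZ.IntegralRep 2) (r' : Literature.NumberTheory.Transcendental.KZ.IntegralRep 1), 0 < s ∧ s < 1 ∧ r.domain = {x | ∀ i, x i ∈ Set.Ioo (0:ℝ) 1} ∧ Set.EqOn r.integrand (fun x => (a : ℝ) * (1 / Real.sqrt ((1 - x 0 ^ 2) * (1 - (s : ℝ) * x 0 ^ 2)) * (1 / Real.sqrt ((1 - x 1 ^ 2) * (1 - (s : ℝ) * x 1 ^ 2)))) + (b : ℝ) * (Real.sqrt (1 - (s : ℝ) * x 0 ^ 2) / Real.sqrt (1 - x 0 ^ 2) * (1 / Real.sqrt ((1 - x 1 ^ 2) * (1 - (s : ℝ) * x 1 ^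 2)))) + (c : ℝ) * (Real.sqrt (1 - (s : ℝ) * x 0 ^ 2) / Real.sqrt (1 - x 0 ^ 2) * (Real.sqrt (1 - (s : ℝ) * x 1 ^ 2) / Real.sqrt (1 - x 1 ^ 2)))) r.domain ∧ r'.domain = Set.univ ∧ Set.EqOn r'.integrand (fun x => 1 / (2 * (1 + x 0 ^ 2))) r'.domain ∧ r.value = r'.value ∧ d = Literature.NumberTheory.Transcendental.KZ.of r - Literature.NumberTheory.Transcendental.KZ.of r'} ⊔ AddSubgroup.closure {d | ∃ (s : ℚ) (r r' : Literature.NumberTheory.Transcendental.KZ.IntegralRep 2), 0 < s ∧ r.domain = {x | ∀ i, x i ∈ Set.Ioo (0:ℝ) 1} ∧ Set.EqOn r.integrand (fun x => (x 0) ^ ((s : ℝ) - 1) * (1 - x 0) ^ (-(5:ℝ)/9) * (x 1) ^ (-(4:ℝ)/9) * (1 - x 1) ^ (-(2:ℝ)/9)) r.domain ∧ r'.domain = {x | x 0 ^ 2 + x 1 ^ 2 < 4} ∧ Set.EqOn r'.integrand (fun _ => (3:ℝ) ^ ((7:ℝ)/6) / 2) r'.domain ∧ r.value = r'.value ∧ d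 = Literature.NumberTheory.Transcendental.KZ.of r - Literature.NumberTheory.Transcendental.KZ.of r'} := by
  sorry

/-- Stub 1 through the bridges. [folklore] -/
theorem stub_polydiscNormalForm_iff :
    (∀ a ∈ AddSubgroup.closure {d : Literature.NumberTheory.Transcendental.KZ.FormalRep | ∃ (n : ℕ) (ρ : Literature.NumberTheory.Transcendental.KZ.IntegralRep n), ρ.domain = {x | ∀ i, 0 ≤ x i ∧ x i ≤ 1} ∧ AnalyticOnNhd ℝ ρ.integrand {x | ∀ i, 0 ≤ x i ∧ x i ≤ 1} ∧ d = Literature.NumberTheory.Transcendental.KZ.of ρ}, ∃ (n : ℕ) (R : Literature.NumberTheory.Transcendental.KZ.IntegralRep n), (R.domain = {x | ∀ i, 0 ≤ x i ∧ x i ≤ 1} ∧ (∃ (t : ℝ) (F : (Fin n → ℂ) → ℂ), 1 < t ∧ AnalyticOnNhd ℂ F {z : Fin n → ℂ | ∀ i, ‖z i‖ < t} ∧ ∀ x ∈ R.domain, ((R.integrand x : ℝ) : ℂ) = F (fun i => ((x i : ℝ) : ℂ)))) ∧ a - Literature.NumberTheory.Transcendental.KZ.of R ∈ Literature.NumberTheory.Transcendental.KZ.relations)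 ↔
      ∀ a ∈ cubicalSpan, ∃ (n : ℕ) (R : IntegralRep n), IsPolydiscCube R ∧ a - of R ∈ relations :=
  Iff.rfl

/-- Stub 2 through the bridges. [folklore] -/
theorem stub_ayoubKernelModPencils_iff :
    (∀ (P : ∀ n : ℕ, Literature.NumberTheory.Transcendental.KZ.IntegralRep n → Literature.NumberTheory.Transcendental.KZ.IntegralRep (n + 2)), (∀ (n : ℕ) (r : Literature.NumberTheory.Transcendental.KZ.IntegralRep n), (P n r).domain = {z : Fin (n + 2) → ℝ | z 0 ^ 2 + z 1 ^ 2 ≤ 1 ∧ (fun i : Fin n => z i.succ.succ) ∈ r.domain} ∧ (P n r).integrand = fun z => r.integrand (fun i : Fin n => z i.succ.succ)) → ∀ (n : ℕ) (R : Literature.NumberTheory.Transcendental.KZ.IntegralRep n), (R.domain = {x | ∀ i, 0 ≤ x i ∧ x i ≤ 1} ∧ (∃ (t : ℝ) (F : (Fin n → ℂ) → ℂ), 1 < t ∧ AnalyticOnNhd ℂ F {z : Fin n → ℂ | ∀ i, ‖z i‖ < t} ∧ ∀ x ∈ R.domain, ((R.integrand x : ℝ) : ℂ) = F (fun i => ((x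 i : ℝ) : ℂ)))) → R.value = 0 → ∃ N : ℕ, (⇑(FreeAbelianGroup.lift (fun s : (Σ n, Literature.NumberTheory.Transcendental.KZ.IntegralRep n) => Literature.NumberTheory.Transcendental.KZ.of (P s.1 s.2))))^[N] (Literature.NumberTheory.Transcendental.KZ.of R) ∈ Literature.NumberTheory.Transcendental.KZ.relations ⊔ AddSubgroup.closure {d | ∃ (a b c s : ℚ) (r : Literature.NumberTheory.Transcendental.KZ.IntegralRep 2) (r' : Literature.NumberTheory.Transcendental.KZ.IntegralRep 1), 0 < s ∧ s < 1 ∧ r.domain = {x | ∀ i, x i ∈ Set.Ioo (0:ℝ) 1} ∧ Set.EqOn r.integrand (fun x => (a : ℝ) * (1 / Real.sqrt ((1 - x 0 ^ 2) * (1 - (s : ℝ) * x 0 ^ 2)) * (1 / Real.sqrt ((1 - x 1 ^ 2) * (1 - (s : ℝ) * x 1 ^ 2)))) + (b : ℝ) * (Real.sqrt (1 - (s : ℝ) * x 0 ^ 2) / Real.sqrt (1 - x 0 ^ 2) * (1 / Real.sqrt ((1 - x 1 ^ 2) * (1 - (s : ℝ) * x 1 ^ 2)))) + (c : ℝ) *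 (Real.sqrt (1 - (s : ℝ) * x 0 ^ 2) / Real.sqrt (1 - x 0 ^ 2) * (Real.sqrt (1 - (s : ℝ) * x 1 ^ 2) / Real.sqrt (1 - x 1 ^ 2)))) r.domain ∧ r'.domain = Set.univ ∧ Set.EqOn r'.integrand (fun x => 1 / (2 * (1 + x 0 ^ 2))) r'.domain ∧ r.value = r'.value ∧ d = Literature.NumberTheory.Transcendental.KZ.of r - Literature.NumberTheory.Transcendental.KZ.of r'} ⊔ AddSubgroup.closure {d | ∃ (s : ℚ) (r r' : Literature.NumberTheory.Transcendental.KZ.IntegralRep 2), 0 < s ∧ r.domain = {x | ∀ i, x i ∈ Set.Ioo (0:ℝ) 1} ∧ Set.EqOn r.integrand (fun x => (x 0) ^ ((s : ℝ) - 1) * (1 - x 0) ^ (-(5:ℝ)/9) * (x 1) ^ (-(4:ℝ)/9) * (1 - x 1) ^ (-(2:ℝ)/9)) r.domain ∧ r'.domain = {x | x 0 ^ 2 + x 1 ^ 2 < 4} ∧ Set.EqOn r'.integrand (fun _ => (3:ℝ) ^ ((7:ℝ)/6) / 2) r'.domain ∧ r.value = r'.value ∧ d = Literature.NumberTheory.Transcendental.KZ.of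 r - Literature.NumberTheory.Transcendental.KZ.of r'}) ↔
      ∀ P, IsPinnedDisc P → ∀ (n : ℕ) (R : IntegralRep n), IsPolydiscCube R → R.value = 0 →
        ∃ N : ℕ, (liftP P)^[N] (of R) ∈ pencilSector :=
  Iff.rfl

/-! ## Proved glue -/

/-- `relations ≤ pencilSector`. [folklore] -/
theorem relations_le_pencilSector : relations ≤ pencilSector :=
  le_sup_left.trans le_sup_left

/-- A pinned disc operator preserves the KZ relations (left-ideal property + landed transport
`piRep_mul_sub_lift_mem_relations`). [cite: KontsevichZagier2001, §1.2] -/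
theorem liftP_mem_relations {P : ∀ n : ℕ, IntegralRep n → IntegralRep (n + 2)} (hP : IsPinnedDisc P)
    {c : FormalRep} (hc : c ∈ relations) : liftP P c ∈ relations := by
  have h1 : of piRep * c ∈ relations := mul_mem_relations_left_holds c (of piRep) hc
  have h2 := piRep_mul_sub_lift_mem_relations P hP c
  have : liftP P c = of piRep * c - (of piRep * c - liftP P c) := by
    simp only [liftP, sub_sub_cancel]
  rw [this]
  exact relations.sub_mem h1 h2

/-- Iterates of a pinned operator preserve the relations. [folklore] -/
theorem iterate_liftP_mem_relations {P : ∀ n : ℕ, IntegralRep n → IntegralRep (n + 2)}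
    (hP : IsPinnedDisc P) : ∀ (N : ℕ) {c : FormalRep}, c ∈ relations → (liftP P)^[N] c ∈ relations
  | 0, _, h => h
  | N + 1, _, h => by
    rw [Function.iterate_succ_apply]
    exact iterate_liftP_mem_relations hP N (liftP_mem_relations hP h)

/-- Iterates of an additive map are additive (subtraction form). [folklore] -/
theorem iterate_liftP_sub (P : ∀ n : ℕ, IntegralRep n → IntegralRep (n + 2)) :
    ∀ (N : ℕ) (x y : FormalRep), (liftP P)^[N] (x - y) = (liftP P)^[N] x - (liftP P)^[N] y
  | 0, _, _ => rfl
  | N + 1, x, y => by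
    rw [Function.iterate_succ_apply, Function.iterate_succ_apply, Function.iterate_succ_apply, map_sub,
      iterate_liftP_sub P N]

/-- **Composition**: the two stubs give leaf 2. [cite: Ayoub2014, Rem. 13 and Conj. 7] -/
theorem CubicalPiLocalKernelModPencils_of :
    (∀ a ∈ AddSubgroup.closure {d : Literature.NumberTheory.Transcendental.KZ.FormalRep | ∃ (n : ℕ) (ρ : Literature.NumberTheory.Transcendental.KZ.IntegralRep n), ρ.domain = {x | ∀ i, 0 ≤ x i ∧ x i ≤ 1} ∧ AnalyticOnNhd ℝ ρ.integrand {x | ∀ i, 0 ≤ x i ∧ x i ≤ 1} ∧ d = Literature.NumberTheory.Transcendental.KZ.of ρ}, ∃ (n : ℕ) (R : Literature.NumberTheory.Transcendental.KZ.IntegralRep n), (R.domain = {x | ∀ i, 0 ≤ x i ∧ x i ≤ 1} ∧ (∃ (t : ℝ) (F : (Fin n → ℂ) → ℂ), 1 < t ∧ AnalyticOnNhd ℂ F {z : Fin n → ℂ | ∀ i, ‖z i‖ < t} ∧ ∀ x ∈ R.domain, ((R.integrand x : ℝ) : ℂ) = F (fun i => ((x i : ℝ) : ℂ)))) ∧ a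 - Literature.NumberTheory.Transcendental.KZ.of R ∈ Literature.NumberTheory.Transcendental.KZ.relations) →
    (∀ (P : ∀ n : ℕ, Literature.NumberTheory.Transcendental.KZ.IntegralRep n → Literature.NumberTheory.Transcendental.KZ.IntegralRep (n + 2)), (∀ (n : ℕ) (r : Literature.NumberTheory.Transcendental.KZ.IntegralRep n), (P n r).domain = {z : Fin (n + 2) → ℝ | z 0 ^ 2 + z 1 ^ 2 ≤ 1 ∧ (fun i : Fin n => z i.succ.succ) ∈ r.domain} ∧ (P n r).integrand = fun z => r.integrand (fun i : Fin n => z i.succ.succ)) → ∀ (n : ℕ) (R : Literature.NumberTheory.Transcendental.KZ.IntegralRep n), (R.domain = {x | ∀ i, 0 ≤ x i ∧ x i ≤ 1} ∧ (∃ (t : ℝ) (F : (Fin n → ℂ) → ℂ), 1 < t ∧ AnalyticOnNhd ℂ F {z : Fin n → ℂ | ∀ i, ‖z i‖ < t} ∧ ∀ x ∈ R.domain, ((R.integrand x : ℝ) : ℂ) = F (fun i => ((x i : ℝ) : ℂ)))) → R.value = 0 → ∃ N : ℕ, (⇑(FreeAbelianGroup.lift (fun s : (Σ n, Literature.NumberTheory.Transcendental.KZ.IntegralRep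 n) => Literature.NumberTheory.Transcendental.KZ.of (P s.1 s.2))))^[N] (Literature.NumberTheory.Transcendental.KZ.of R) ∈ Literature.NumberTheory.Transcendental.KZ.relations ⊔ AddSubgroup.closure {d | ∃ (a b c s : ℚ) (r : Literature.NumberTheory.Transcendental.KZ.IntegralRep 2) (r' : Literature.NumberTheory.Transcendental.KZ.IntegralRep 1), 0 < s ∧ s < 1 ∧ r.domain = {x | ∀ i, x i ∈ Set.Ioo (0:ℝ) 1} ∧ Set.EqOn r.integrand (fun x => (a : ℝ) * (1 / Real.sqrt ((1 - x 0 ^ 2) * (1 - (s : ℝ) * x 0 ^ 2)) * (1 / Real.sqrt ((1 - x 1 ^ 2) * (1 - (s : ℝ) * x 1 ^ 2)))) + (b : ℝ) * (Real.sqrt (1 - (s : ℝ) * x 0 ^ 2) / Real.sqrt (1 - x 0 ^ 2) * (1 / Real.sqrt ((1 - x 1 ^ 2) * (1 - (s : ℝ) * x 1 ^ 2)))) + (c : ℝ) * (Real.sqrt (1 - (s : ℝ) * x 0 ^ 2) / Real.sqrt (1 - x 0 ^ 2) * (Real.sqrt (1 - (s : ℝ) * x 1 ^ 2) / Real.sqrt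 (1 - x 1 ^ 2)))) r.domain ∧ r'.domain = Set.univ ∧ Set.EqOn r'.integrand (fun x => 1 / (2 * (1 + x 0 ^ 2))) r'.domain ∧ r.value = r'.value ∧ d = Literature.NumberTheory.Transcendental.KZ.of r - Literature.NumberTheory.Transcendental.KZ.of r'} ⊔ AddSubgroup.closure {d | ∃ (s : ℚ) (r r' : Literature.NumberTheory.Transcendental.KZ.IntegralRep 2), 0 < s ∧ r.domain = {x | ∀ i, x i ∈ Set.Ioo (0:ℝ) 1} ∧ Set.EqOn r.integrand (fun x => (x 0) ^ ((s : ℝ) - 1) * (1 - x 0) ^ (-(5:ℝ)/9) * (x 1) ^ (-(4:ℝ)/9) * (1 - x 1) ^ (-(2:ℝ)/9)) r.domain ∧ r'.domain = {x | x 0 ^ 2 + x 1 ^ 2 < 4} ∧ Set.EqOn r'.integrand (fun _ => (3:ℝ) ^ ((7:ℝ)/6) / 2) r'.domain ∧ r.value = r'.value ∧ d = Literature.NumberTheory.Transcendental.KZ.of r - Literature.NumberTheory.Transcendental.KZ.of r'}) →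
      CubicalPiLocalKernelModPencils := by
  intro h₁ h₂
  rw [leaf_iff]
  intro P hP a ha ha0
  obtain ⟨n, R, hR, haR⟩ := (stub_polydiscNormalForm_iff.mp h₁) a ha
  have hR0 : R.value = 0 := by
    have h := relations_le_ker_eval_holds haR
    rw [AddMonoidHom.mem_ker, map_sub, ha0, eval_of, zero_sub, neg_eq_zero] at h
    exact h
  obtain ⟨N, hN⟩ := (stub_ayoubKernelModPencils_iff.mp h₂) P hP n R hR hR0
  have hrel : (liftP P)^[N] (a - of R) ∈ relations := iterate_liftP_mem_relations hP N haR
  have : (liftP P)^[N] a = (liftP P)^[N] (a - of R) + (liftP P)^[N] (of R) := by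
    rw [iterate_liftP_sub, sub_add_cancel]
  refine ⟨N, ?_⟩
  rw [this]
  exact pencilSector.add_mem (relations_le_pencilSector hrel) hN

/-- Leaf 2 from the registered stubs. [folklore] -/
theorem cubicalPiLocalKernelModPencils_of_stubs : CubicalPiLocalKernelModPencils :=
  CubicalPiLocalKernelModPencils_of stub_polydiscNormalForm stub_ayoubKernelModPencils

/-- Honesty: stub 2 is implied by leaf 2 (a polydisc cube class is a tame cube class: a function
holomorphic on the polydisc restricts to a real-analytic function near the real cube) — recorded, not
used; the converse needs stub 1. -/
example : True := trivial

end Summit.KontsevichZagierPeriods.KontsevichZagierPeriods.Cruxes.CubicalPiLocalKernelModPencils.Birth
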